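import Summits.HubbardSuperconductivity.HubbardSuperconductivity.Theorems.SoloBlindMottCounting
import HarnessLib

/-!
# Plaquette Mott floor — definitions (Theorem 42, part 1/5)

Solo-blind programme `HubbardSuperconductivity`, generation 55 — the *plaquette Mott floor*
(Theorem 42, `SoloBlindPlaquetteMottFloor.plaquette_mott_floor`): for `U ≥ 16`, `L` even and every
`N`-particle `ψ`, `re ⟨ψ, H_U ψ⟩ ≥ -(4 N_h - (2 - √2)·max(0, 4 N_h - L²) + 64 L²/U) ‖ψ‖²`,
`N_h = L² - N`, sharpening the Mott floor `-(4 N_h + 64 L²/U)` of `SoloBlindMottFloor` by letting the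
AM–GM weight of a (sign-free) hole hop depend on the hole pattern of the black plaquette containing
the bond.

This file holds the bookkeeping objects only (all finite and elementary):
* a plaquette has corners `c : Fin 4` in cyclic order and eight local ordered bonds
  `i : Fin 4 × Bool` from `src i` to `dst i`; for an emptiness pattern `E : Fin 4 → Bool`: the hole
  number `cnt E`, the number `mixed E` of local ordered bonds with exactly one empty end, the diagonal
  two-hole patterns `IsDiag E`, the weight `wt E` (`√2/4` diagonal, `√2/2` adjacent two-hole, `½`
  otherwise) and the patterns `hopA E i` / `hopB E i` on the two sides of a hole hop along `i`;
* on the torus `(ℤ/L)²`: the black plaquettes `IsBlack k` (`k₁ + k₂` even), `blackSet L`, the corner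
  offsets `off c`;
* for the Hubbard configurations `s : Finset (Orb Λ)`: the bond weights `wA`, `wB`, `W` of
  `SoloBlindMottFloor` with a free hole-hop weight `w`, the corner sites `site k c`, the pattern
  `pat k s`, the plaquette weight `pw k s = wt (pat k s)` and the hole charge
  `holeCharge s = Σ_{k black} wt (pat k s) · mixed (pat k s)`.

[this work]
-/

noncomputable section

namespace Summit.HubbardSuperconductivity.HubbardSuperconductivity.Theorems.PlaquetteMottFloor

open Matrix Finset Literature.Probability.LatticeModels Literature.MathematicalPhysics.QuantumLattice
  Literature.MathematicalPhysics.QuantumLattice.EigenvalueContinuation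
  Summit.HubbardSuperconductivity.HubbardSuperconductivity.Theorems.MottFloor
open scoped ComplexOrder ComplexConjugate

/-! ### Patterns on a four-cycle -/

section Pattern

/-- Source corner of the local ordered bond `i = (c, b)`: `c → c+1` if `b`, else `c+1 → c`. -/
def src (i : Fin 4 × Bool) : Fin 4 := if i.2 then i.1 else i.1 + 1

/-- Target corner of the local ordered bond `i = (c, b)`. -/
def dst (i : Fin 4 × Bool) : Fin 4 := if i.2 then i.1 + 1 else i.1

/-- Number of empty corners of a pattern. -/
def cnt (E : Fin 4 → Bool) : ℕ := (univ.filter fun c => E c = true).card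

/-- Number of local ordered bonds with exactly one empty end. -/
def mixed (E : Fin 4 → Bool) : ℕ := (univ.filter fun i : Fin 4 × Bool => E (src i) ≠ E (dst i)).card

/-- The two diagonal two-hole patterns. -/
def IsDiag (E : Fin 4 → Bool) : Prop :=
  E = ![true, false, true, false] ∨ E = ![false, true, false, true]

/-- `IsDiag` is decidable. -/
instance instDecidablePredIsDiag : DecidablePred IsDiag :=
  fun E => inferInstanceAs (Decidable (E = ![true, false, true, false] ∨ E = ![false, true, false, true]))

/-- The AM–GM weight attached to a configuration by a hole hop inside the plaquette:
`√2/4` on a diagonal two-hole pattern, `√2/2` on an adjacent two-hole pattern, `½` otherwise. -/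
def wt (E : Fin 4 → Bool) : ℝ :=
  if cnt E = 2 then (if IsDiag E then Real.sqrt 2 / 4 else Real.sqrt 2 / 2) else 1 / 2

/-- The pattern after the hole hop along `i` on the side where `src i` is occupied and `dst i` is
empty. -/
def hopA (E : Fin 4 → Bool) (i : Fin 4 × Bool) : Fin 4 → Bool :=
  Function.update (Function.update E (src i) false) (dst i) true

/-- The pattern on the other side of the same hop (`src i` empty, `dst i` occupied). -/
def hopB (E : Fin 4 → Bool) (i : Fin 4 × Bool) : Fin 4 → Bool :=
  Function.update (Function.update E (src i) true) (dst i) false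

/-- The two ends of a local bond are different corners. [folklore] -/
theorem src_ne_dst (i : Fin 4 × Bool) : src i ≠ dst i := by
  revert i; decide

/-- Local bonds in coordinates (definitional). [folklore] -/
theorem src_true (c : Fin 4) : src (c, true) = c := rfl

/-- Local bonds in coordinates (definitional). [folklore] -/
theorem dst_true (c : Fin 4) : dst (c, true) = c + 1 := rfl

/-- Local bonds in coordinates (definitional). [folklore] -/
theorem src_false (c : Fin 4) : src (c, false) = c + 1 := rfl

/-- Local bonds in coordinates (definitional). [folklore] -/
theorem dst_false (c : Fin 4) : dst (c, false) = c := rfl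

end Pattern

/-! ### Black plaquettes and corner offsets -/

variable {L : ℕ} [NeZero L]

/-- The plaquette with lower-left corner `k` is black: `k₁ + k₂` is even. -/
def IsBlack (k : TorusSite 2 L) : Prop := ((k 0).val + (k 1).val) % 2 = 0

/-- `IsBlack` is decidable. -/
instance instDecidablePredIsBlack : DecidablePred (IsBlack (L := L)) :=
  fun k => inferInstanceAs (Decidable (((k 0).val + (k 1).val) % 2 = 0))

/-- The set of black plaquettes (by lower-left corner). -/
def blackSet (L : ℕ) [NeZero L] : Finset (TorusSite 2 L) := univ.filter IsBlack

/-- The four corner offsets in cyclic order: `0, e₁, e₁ + e₂, e₂`. -/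
def off : Fin 4 → TorusSite 2 L :=
  ![0, Pi.single 0 1, Pi.single 0 1 + Pi.single 1 1, Pi.single 1 1]

/-- Membership in `blackSet`. [folklore] -/
theorem mem_blackSet {k : TorusSite 2 L} : k ∈ blackSet L ↔ IsBlack k := by
  simp [blackSet]

omit [NeZero L] in
/-- Values of the corner offsets (definitional). [folklore] -/
theorem off_zero : off (L := L) 0 = 0 := rfl

omit [NeZero L] in
/-- Values of the corner offsets (definitional). [folklore] -/
theorem off_one : off (L := L) 1 = Pi.single 0 1 := rfl

omit [NeZero L] in
/-- Values of the corner offsets (definitional). [folklore] -/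
theorem off_two : off (L := L) 2 = Pi.single 0 1 + Pi.single 1 1 := rfl

omit [NeZero L] in
/-- Values of the corner offsets (definitional). [folklore] -/
theorem off_three : off (L := L) 3 = Pi.single 1 1 := rfl

/-! ### Hubbard bond weights with a free hole-hop weight; plaquette weights -/

/-- Pin `DecidableEq` on orbitals to the order-derived instance used by the orbital-generic
fermion lemmas of `SoloBlindMottCounting` (the weights below are unfolded against them; without the
pin, instance unification in `if _ ∈ insert _ _` terms times out). [folklore] -/
local instance (priority := high) instDecidableEqOrbTorusPlaq :
    DecidableEq (Orb (FermionTorus 2 L)) := LinearOrder.toDecidableEq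

/-- Pin `DecidableEq` on sites likewise. [folklore] -/
local instance (priority := high) instDecidableEqTorusPlaq :
    DecidableEq (FermionTorus 2 L) := LinearOrder.toDecidableEq

/-- Weight on the side where `(x,σ)` is occupied: `½` (doublon moves), `α` (doublon at `x`
created), `β` (doublon at `y` destroyed), and the free weight `w s` for a hole hop. -/
def wA (α β : ℝ) (w : Finset (Orb (FermionTorus 2 L)) → ℝ) (x y : FermionTorus 2 L) (σ : Fin 2)
    (s : Finset (Orb (FermionTorus 2 L))) : ℝ :=
  if orb x (1 - σ) ∈ s then (if orb y (1 - σ) ∈ s then 1 / 2 else α)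
  else (if orb y (1 - σ) ∈ s then β else w s)

/-- Weight on the side where `(y,σ)` is occupied (mirror of `wA`). -/
def wB (α β : ℝ) (w : Finset (Orb (FermionTorus 2 L)) → ℝ) (x y : FermionTorus 2 L) (σ : Fin 2)
    (s : Finset (Orb (FermionTorus 2 L))) : ℝ :=
  if orb x (1 - σ) ∈ s then (if orb y (1 - σ) ∈ s then 1 / 2 else β)
  else (if orb y (1 - σ) ∈ s then α else w s)

/-- The total weight `W_s(x,y,σ)` received by `s` from the bond term `c†_{xσ} c_{yσ}`. -/
def W (α β : ℝ) (w : Finset (Orb (FermionTorus 2 L)) → ℝ) (s : Finset (Orb (FermionTorus 2 L)))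
    (x y : FermionTorus 2 L) (σ : Fin 2) : ℝ :=
  (if orb x σ ∈ s ∧ orb y σ ∉ s then wA α β w x y σ s else 0) +
    (if orb y σ ∈ s ∧ orb x σ ∉ s then wB α β w x y σ s else 0)

/-- The corner `c` of the plaquette with lower-left corner `k`, as a site of the fermionic torus. -/
def site (k : TorusSite 2 L) (c : Fin 4) : FermionTorus 2 L := FermionTorus.ofTorusSite (k + off c)

/-- The emptiness pattern of the configuration `s` on the plaquette `k`. -/
def pat (k : TorusSite 2 L) (s : Finset (Orb (FermionTorus 2 L))) : Fin 4 → Bool :=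
  fun c => decide (IsEmp s (site k c))

/-- The plaquette weight function of the plaquette `k`: `wt` of the pattern. -/
def pw (k : TorusSite 2 L) (s : Finset (Orb (FermionTorus 2 L))) : ℝ := wt (pat k s)

/-- The hole charge of a configuration: `Σ_{k black} wt(pattern) · mixed(pattern)`. -/
def holeCharge (s : Finset (Orb (FermionTorus 2 L))) : ℝ :=
  ∑ k ∈ blackSet L, wt (pat k s) * (mixed (pat k s) : ℝ)

end Summit.HubbardSuperconductivity.HubbardSuperconductivity.Theorems.PlaquetteMottFloor
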